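import Mathlib
import HarnessLib
import Summits.Ventures.LatticeQCDFlow.Exactness.SphereIndependenceSamplerAcceptance
import Summits.Ventures.LatticeQCDFlow.Exactness.LatticeBlockSecondMomentTensorization

/-!
# The acceptance ceiling of an independence sampler on the lattice of spheres: `acc ≤ (∫e^{−F/2}dπ̄)²/∫e^{−F}dπ̄` (the squared Bhattacharyya affinity of target and proposal), and its block tensorization `acc·exp(Σ_j e^{−2M_j}Var(A_C h_j)/(4 + M_j²)) ≤ e^{2δ}` for a log-weight within `δ` of a sum of block-local terms

HONEST FRAMING: exact (Metropolis-corrected) sampling algorithms for lattice gauge theory;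
figures of merit are autocorrelation/cost numbers at stated couplings and volumes; no
continuum-physics claim.

Venture `LatticeQCDFlow` (cell pub-lqcd), topic `Exactness`; FANOUT row 7 (`s0-cpn-null`: the
S0-D1 rung — 2D CP⁹, Lüscher's LO trivializing map inside HMC, Engel–Schaefer 2011).  NEW WORK of
the cell over this lineage's `Exactness/SphereIndependenceSamplerAcceptance.lean`
(`indepSampler_meanAccept_eq`: the mean Metropolis acceptance at stationarity of the independence
sampler with target `π̄.tilted(−F)` and proposal `π̄` is `∫∫e^{−max(F,F')}dπ̄dπ̄/∫e^{−F}dπ̄`) and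
`Exactness/LatticeBlockSecondMomentTensorization.lean` (the tensorized second-moment floor
`(∫e^{−G})²·exp(Σ_j e^{−4M_j}Var(A_C h_j)/(1 + M_j²)) ≤ e^{4δ}∫e^{−2G}` for `G` within `δ` of
`Σ_j h_j + r`, `h_j` block-local); nothing is cited as a fact.  Printed counterparts, NAMED ONLY: the
flow-based independence Metropolis sampler of Albergo–Kanwar–Shanahan, Phys. Rev. D 100 (2019)
034515, §II; the Bhattacharyya / Hellinger affinity `∫√(pq)` [folklore]; Abbott et al., Phys. Rev.
D 106 (2022) 074506, §V ("for fixed models the acceptance rate degrades exponentially in the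
volume").  TREE COUNTERPARTS (other rows, named only, not imported): row 3's
`Scaling/AcceptanceVolumeDecayPi.lean` (`Theory2.meanAccept_le_sq_integral_sqrt`: `acc ≤ BC²` on
densities over any measure space, and the geometric volume law `acc(⊗pᵢ, ⊗qᵢ) ≤ Π BCᵢ²` for
PRODUCT targets and models) and row 2's `Exactness/IMH*.lean` / `FlowSampler*.lean` (the chain-level
consequences of the acceptance column: `τ_int` floors by sticking).  THIS FILE is (a) the same
ceiling in this lineage's vocabulary (a continuous log-weight `F` against `π̄ = ⊗_Λ σ̄` on the lattice
of spheres, proposal `π̄`, the closed form `indepSampler_meanAccept_eq`), and (b) — the new content —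
its tensorization WITHOUT product structure: target `π̄.tilted(−F)` and proposal `π̄` are not products
over blocks; only the log-weight is, up to `δ`, a sum of block-local terms plus a corridor term, and
the blocks are decoupled by the corridor conditional expectation `A_C` of the lineage's second-moment
tensorization — the form needed for flow samplers, whose effective action is local only up to
light-cone tails.  THE MECHANISM AS A THEOREM.  Since `max(a, b) ≥ (a + b)/2`,
`∫∫e^{−max(F(ω),F(ω'))} ≤ (∫e^{−F/2})²`, so the mean acceptance is at most the second-moment
("effective sample size") functional `(∫u)²/∫u²` OF THE HALF WEIGHT `u = e^{−F/2}` — the squared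
Bhattacharyya affinity of target and proposal; the tensorized second-moment floor of the lineage,
applied to `F/2`, then bounds the acceptance by `e^{2δ}` times a PRODUCT over blocks of factors
`exp(−e^{−2M_j}Var(A_C h_j)/(4 + M_j²)) < 1`: an independence sampler whose log-weight is, up to `δ`,
a sum of `#T` congruent block-local terms with non-degenerate conditional fluctuations accepts with
probability at most `exp(−#T·θ + 2δ)`.

## Content

* §1 `integral_integral_exp_neg_max_le` — on a compact metric probability space, for continuous `F`:
  `∫∫ e^{−max(F(y),F(y'))} ≤ (∫ e^{−F/2})²`.
* §2 **`meanAccept_le_sq_integral_exp_neg_half_div`** — on `Ω = S(E)^Λ`: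
  `acc ≤ (∫e^{−F/2}dπ̄)²/∫e^{−F}dπ̄`; `meanAccept_le_one`.
* §3 **`meanAccept_mul_exp_blockSum_le`** — THE TENSORIZED ACCEPTANCE CEILING: blocks `B_j ⊆ D_j`
  with the `D_j` pairwise disjoint (`j ∈ T`), `h_j` continuous depending on `D_j` with oscillation
  `≤ M_j`, `r` continuous depending on the complement of `⋃_j B_j`, `C = Λ ∖ ⋃_j B_j`, and
  `|F − (Σ_j h_j + r)| ≤ δ`: `acc · exp(Σ_j e^{−2M_j}·Var_π̄(A_C h_j)/(4 + M_j²)) ≤ e^{2δ}`.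

NOT CLAIMED: anything model-specific (the sequel instantiates `F = S_eff` of the exact leading-order
flow); autocorrelation times; lower bounds (those are `SphereIndependenceSamplerAcceptance` /
`SphereLOFlowAcceptance`); numbers.
-/

noncomputable section

namespace Summit.Ventures.LatticeQCDFlow.Exactness

open Function Set Metric MeasureTheory NormedSpace InnerProductSpace
open scoped RealInnerProductSpace Topology

/-! ## §1 The pair integral of `e^{−max}` is at most the square of `∫e^{−F/2}` -/

section Pair

variable {Y : Type*} [MetricSpace Y] [CompactSpace Y] [MeasurableSpace Y] [BorelSpace Y]
  (ν : Measure Y) [IsProbabilityMeasure ν] {F : Y → ℝ}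

/-- **`∫∫ e^{−max(F(y),F(y'))} ≤ (∫ e^{−F/2})²`** for continuous `F` on a compact metric probability
space (`max(a,b) ≥ (a+b)/2`, then Fubini for the product integrand). -/
theorem integral_integral_exp_neg_max_le (hF : Continuous F) :
    ∫ y, ∫ y', Real.exp (-max (F y) (F y')) ∂ν ∂ν ≤ (∫ y, Real.exp (-(F y / 2)) ∂ν) ^ 2 := by
  have hhc : Continuous fun y => Real.exp (-(F y / 2)) := (hF.div_const 2).neg.rexp
  have hhi : Integrable (fun y => Real.exp (-(F y / 2))) ν := integrable_of_continuous_compact ν hhc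
  -- inner estimate at fixed `y`
  have hinner : ∀ y, ∫ y', Real.exp (-max (F y) (F y')) ∂ν ≤
      Real.exp (-(F y / 2)) * ∫ y', Real.exp (-(F y' / 2)) ∂ν := by
    intro y
    rw [← integral_const_mul]
    refine integral_mono (integrable_of_continuous_compact ν
      (Real.continuous_exp.comp (continuous_const.max hF).neg)) (hhi.const_mul _) fun y' => ?_
    show Real.exp (-max (F y) (F y')) ≤ Real.exp (-(F y / 2)) * Real.exp (-(F y' / 2))
    rw [← Real.exp_add]
    refine Real.exp_le_exp.2 ?_
    have h1 := le_max_left (F y) (F y')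
    have h2 := le_max_right (F y) (F y')
    linarith
  have hoc : Continuous fun y => ∫ y', Real.exp (-max (F y) (F y')) ∂ν := by
    have hf : Continuous (uncurry fun (y : Y) (y' : Y) => Real.exp (-max (F y) (F y'))) :=
      Real.continuous_exp.comp ((hF.comp continuous_fst).max (hF.comp continuous_snd)).neg
    have h := continuous_parametric_integral_of_continuous (μ := ν) hf isCompact_univ
    simp only [Measure.restrict_univ] at h
    exact h
  calc ∫ y, ∫ y', Real.exp (-max (F y) (F y')) ∂ν ∂ν
      ≤ ∫ y, Real.exp (-(F y / 2)) * ∫ y', Real.exp (-(F y' / 2)) ∂ν ∂ν :=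
        integral_mono (integrable_of_continuous_compact ν hoc) (hhi.mul_const _) hinner
    _ = (∫ y, Real.exp (-(F y / 2)) ∂ν) ^ 2 := by rw [integral_mul_const, sq]

end Pair

/-! ## §2 The acceptance ceiling of the independence sampler on the lattice of spheres -/

section Acceptance

variable {Λ : Type*} {E : Type*} [NormedAddCommGroup E] [InnerProductSpace ℝ E]
  [FiniteDimensional ℝ E] [Fintype Λ] [DecidableEq Λ] [MeasurableSpace E] [BorelSpace E] [Nontrivial E]

omit [DecidableEq Λ] in
/-- **THE ACCEPTANCE CEILING.**  For every continuous log-weight `F` on `Ω`, the mean Metropolis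
acceptance of the independence sampler with target `π̄.tilted(−F)` and proposal `π̄` satisfies
`acc ≤ (∫ e^{−F/2} dπ̄)² / ∫ e^{−F} dπ̄` — the squared Bhattacharyya affinity of target and proposal,
i.e. the second-moment functional `(∫u dπ̄)²/∫u² dπ̄` of the half weight `u = e^{−F/2}`. -/
theorem meanAccept_le_sq_integral_exp_neg_half_div {F : (Λ → sphere (0 : E) 1) → ℝ}
    (hF : Continuous F) :
    ∫ ω, (∫ ω', min 1 (Real.exp (F ω - F ω'))
        ∂Measure.pi (fun _ : Λ => uniformSphere (volume : Measure E)))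
      ∂(Measure.pi (fun _ : Λ => uniformSphere (volume : Measure E))).tilted (fun ω => -F ω) ≤
      (∫ ω, Real.exp (-(F ω / 2)) ∂Measure.pi (fun _ : Λ => uniformSphere (volume : Measure E))) ^ 2 /
        ∫ ω, Real.exp (-F ω) ∂Measure.pi (fun _ : Λ => uniformSphere (volume : Measure E)) := by
  set μ : Measure (Λ → sphere (0 : E) 1) := Measure.pi (fun _ : Λ => uniformSphere (volume : Measure E))
    with hμ
  rw [indepSampler_meanAccept_eq F]
  have hZpos : 0 < ∫ ω, Real.exp (-F ω) ∂μ :=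
    integral_exp_pos (integrable_pi_of_continuous _ (Real.continuous_exp.comp hF.neg))
  exact div_le_div_of_nonneg_right (integral_integral_exp_neg_max_le μ hF) hZpos.le

omit [DecidableEq Λ] in
/-- The ceiling is at most one: `(∫ e^{−F/2} dπ̄)² ≤ ∫ e^{−F} dπ̄` (Cauchy–Schwarz), so in particular
`acc ≤ 1` is recovered from `meanAccept_le_sq_integral_exp_neg_half_div`. -/
theorem meanAccept_le_one {F : (Λ → sphere (0 : E) 1) → ℝ} (hF : Continuous F) :
    ∫ ω, (∫ ω', min 1 (Real.exp (F ω - F ω'))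
        ∂Measure.pi (fun _ : Λ => uniformSphere (volume : Measure E)))
      ∂(Measure.pi (fun _ : Λ => uniformSphere (volume : Measure E))).tilted (fun ω => -F ω) ≤ 1 := by
  set μ : Measure (Λ → sphere (0 : E) 1) := Measure.pi (fun _ : Λ => uniformSphere (volume : Measure E))
    with hμ
  refine (meanAccept_le_sq_integral_exp_neg_half_div hF).trans ?_
  have hZpos : 0 < ∫ ω, Real.exp (-F ω) ∂μ :=
    integral_exp_pos (integrable_pi_of_continuous _ (Real.continuous_exp.comp hF.neg))
  rw [div_le_one hZpos]
  -- Cauchy–Schwarz `(∫u)² ≤ ∫u²` on a probability space, `u = e^{−F/2}`, `u² = e^{−F}`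
  have huc : Continuous fun ω : Λ → sphere (0 : E) 1 => Real.exp (-(F ω / 2)) := (hF.div_const 2).neg.rexp
  have hui : Integrable (fun ω => Real.exp (-(F ω / 2))) μ := integrable_pi_of_continuous _ huc
  have hu2 : Integrable (fun ω => Real.exp (-(F ω / 2)) ^ 2) μ := integrable_pi_of_continuous _ (huc.pow 2)
  have hcs := sq_integral_abs_le_integral_sq (ν := μ) hui hu2
  have e1 : ∫ ω, |Real.exp (-(F ω / 2))| ∂μ = ∫ ω, Real.exp (-(F ω / 2)) ∂μ :=
    integral_congr_ae (ae_of_all _ fun ω => abs_of_pos (Real.exp_pos _))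
  have e2 : ∫ ω, Real.exp (-(F ω / 2)) ^ 2 ∂μ = ∫ ω, Real.exp (-F ω) ∂μ := by
    refine integral_congr_ae (ae_of_all _ fun ω => ?_)
    show Real.exp (-(F ω / 2)) ^ 2 = Real.exp (-F ω)
    rw [sq, ← Real.exp_add]; congr 1; ring
  rw [e1, e2] at hcs
  exact hcs

end Acceptance

/-! ## §3 The tensorized acceptance ceiling -/

section Blocks

variable {Λ : Type*} {E : Type*} [NormedAddCommGroup E] [InnerProductSpace ℝ E]
  [FiniteDimensional ℝ E] [Fintype Λ] [DecidableEq Λ] [MeasurableSpace E] [BorelSpace E] [Nontrivial E]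

/-- **THE TENSORIZED ACCEPTANCE CEILING.**  Blocks `B_j ⊆ D_j` with the `D_j` pairwise disjoint
(`j ∈ T`); `h_j` continuous, depending on `D_j`, with oscillation `≤ M_j` (`0 ≤ M_j`); `r` continuous
depending on the complement of `⋃_j B_j`; `C = Λ ∖ ⋃_j B_j`; a continuous log-weight `F` with
`|F − (Σ_j h_j + r)| ≤ δ` on `Ω`.  Then the mean Metropolis acceptance of the independence sampler with
target `π̄.tilted(−F)` and proposal `π̄` satisfies
`acc · exp(Σ_j e^{−2M_j}·∫(A_C h_j − ∫h_j)²dπ̄/(4 + M_j²)) ≤ e^{2δ}`. -/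
theorem meanAccept_mul_exp_blockSum_le {J : Type*} (T : Finset J) (B D : J → Finset Λ)
    (hBD : ∀ j ∈ T, B j ⊆ D j) (hD : ∀ j ∈ T, ∀ j' ∈ T, j ≠ j' → Disjoint (D j) (D j'))
    {h : J → (Λ → sphere (0 : E) 1) → ℝ} (hc : ∀ j ∈ T, Continuous (h j))
    (hdep : ∀ j ∈ T, DependsOn (h j) ↑(D j))
    {M : J → ℝ} (hM0 : ∀ j ∈ T, 0 ≤ M j) (hM : ∀ j ∈ T, ∀ ω ω', |h j ω - h j ω'| ≤ M j)
    {r : (Λ → sphere (0 : E) 1) → ℝ} (hr : Continuous r) (hrdep : DependsOn r (↑(T.biUnion B) : Set Λ)ᶜ)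
    {F : (Λ → sphere (0 : E) 1) → ℝ} (hF : Continuous F) {δ : ℝ}
    (hδ : ∀ ω, |F ω - (∑ j ∈ T, h j ω + r ω)| ≤ δ) :
    (∫ ω, (∫ ω', min 1 (Real.exp (F ω - F ω'))
        ∂Measure.pi (fun _ : Λ => uniformSphere (volume : Measure E)))
      ∂(Measure.pi (fun _ : Λ => uniformSphere (volume : Measure E))).tilted (fun ω => -F ω)) *
      Real.exp (∑ j ∈ T, Real.exp (-2 * M j) *
        (∫ ω, (coordAvg (uniformSphere (volume : Measure E)) (Finset.univ \ T.biUnion B) (h j) ω -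
            ∫ ω', h j ω' ∂Measure.pi (fun _ : Λ => uniformSphere (volume : Measure E))) ^ 2
          ∂Measure.pi (fun _ : Λ => uniformSphere (volume : Measure E))) / (4 + M j ^ 2)) ≤
      Real.exp (2 * δ) := by
  set σ : Measure (sphere (0 : E) 1) := uniformSphere (volume : Measure E) with hσ
  set μ : Measure (Λ → sphere (0 : E) 1) := Measure.pi (fun _ : Λ => σ) with hμ
  -- the half data
  set h' : J → (Λ → sphere (0 : E) 1) → ℝ := fun j ω => (1 / 2) * h j ω with hh'
  set r' : (Λ → sphere (0 : E) 1) → ℝ := fun ω => (1 / 2) * r ω with hr'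
  set F' : (Λ → sphere (0 : E) 1) → ℝ := fun ω => (1 / 2) * F ω with hF'
  have hc' : ∀ j ∈ T, Continuous (h' j) := fun j hj => continuous_const.mul (hc j hj)
  have hdep' : ∀ j ∈ T, DependsOn (h' j) ↑(D j) := fun j hj ω ω' hag => by
    show (1 / 2) * h j ω = (1 / 2) * h j ω'
    rw [hdep j hj hag]
  have hM0' : ∀ j ∈ T, 0 ≤ M j / 2 := fun j hj => by linarith [hM0 j hj]
  have hM' : ∀ j ∈ T, ∀ ω ω', |h' j ω - h' j ω'| ≤ M j / 2 := by
    intro j hj ω ω'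
    show |(1 / 2) * h j ω - (1 / 2) * h j ω'| ≤ M j / 2
    rw [← mul_sub, abs_mul, abs_of_pos (by norm_num : (0 : ℝ) < 1 / 2)]
    linarith [hM j hj ω ω']
  have hr'c : Continuous r' := continuous_const.mul hr
  have hr'dep : DependsOn r' (↑(T.biUnion B) : Set Λ)ᶜ := fun ω ω' hag => by
    show (1 / 2) * r ω = (1 / 2) * r ω'
    rw [hrdep hag]
  have hF'c : Continuous F' := continuous_const.mul hF
  have hδ' : ∀ ω, |F' ω - (∑ j ∈ T, h' j ω + r' ω)| ≤ δ / 2 := by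
    intro ω
    have e : F' ω - (∑ j ∈ T, h' j ω + r' ω) = (1 / 2) * (F ω - (∑ j ∈ T, h j ω + r ω)) := by
      simp only [hF', hh', hr']
      rw [← Finset.mul_sum]
      ring
    rw [e, abs_mul, abs_of_pos (by norm_num : (0 : ℝ) < 1 / 2)]
    linarith [hδ ω]
  have hmain := sq_integral_exp_neg_mul_exp_le_of_abs_sub_le σ T B D hBD hD hc' hdep' hM0' hM'
    hr'c hr'dep hF'c hδ'
  -- identify the pieces: `A_C h'_j = (1/2)A_C h_j`, `e^{−F'} = e^{−F/2}`, `e^{−2F'} = e^{−F}`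
  have hA : ∀ j ∈ T, ∀ ω, coordAvg σ (Finset.univ \ T.biUnion B) (h' j) ω =
      (1 / 2) * coordAvg σ (Finset.univ \ T.biUnion B) (h j) ω := fun j _ ω =>
    coordAvg_mul_left σ (Finset.univ \ T.biUnion B) (Φ := fun _ => (1 / 2 : ℝ)) (fun _ _ => rfl) ω
  have hI : ∀ j ∈ T, ∫ ω', h' j ω' ∂μ = (1 / 2) * ∫ ω', h j ω' ∂μ := fun j _ => integral_const_mul _ _
  have hV : ∀ j ∈ T, ∫ ω, (coordAvg σ (Finset.univ \ T.biUnion B) (h' j) ω - ∫ ω', h' j ω' ∂μ) ^ 2 ∂μ =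
      (1 / 4) * ∫ ω, (coordAvg σ (Finset.univ \ T.biUnion B) (h j) ω - ∫ ω', h j ω' ∂μ) ^ 2 ∂μ := by
    intro j hj
    rw [← integral_const_mul]
    refine integral_congr_ae (ae_of_all _ fun ω => ?_)
    show (coordAvg σ (Finset.univ \ T.biUnion B) (h' j) ω - ∫ ω', h' j ω' ∂μ) ^ 2 =
      (1 / 4) * (coordAvg σ (Finset.univ \ T.biUnion B) (h j) ω - ∫ ω', h j ω' ∂μ) ^ 2
    rw [hA j hj ω, hI j hj]
    ring
  have hS : ∑ j ∈ T, Real.exp (-4 * (M j / 2)) *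
        (∫ ω, (coordAvg σ (Finset.univ \ T.biUnion B) (h' j) ω - ∫ ω', h' j ω' ∂μ) ^ 2 ∂μ) /
          (1 + (M j / 2) ^ 2) =
      ∑ j ∈ T, Real.exp (-2 * M j) *
        (∫ ω, (coordAvg σ (Finset.univ \ T.biUnion B) (h j) ω - ∫ ω', h j ω' ∂μ) ^ 2 ∂μ) / (4 + M j ^ 2) := by
    refine Finset.sum_congr rfl fun j hj => ?_
    rw [hV j hj, show -4 * (M j / 2) = -2 * M j by ring]
    have h4 : (4 : ℝ) + M j ^ 2 ≠ 0 := by positivity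
    have h1 : (1 : ℝ) + (M j / 2) ^ 2 ≠ 0 := by positivity
    field_simp
    ring
  have e1 : ∫ ω, Real.exp (-F' ω) ∂μ = ∫ ω, Real.exp (-(F ω / 2)) ∂μ := by
    refine integral_congr_ae (ae_of_all _ fun ω => ?_)
    show Real.exp (-((1 / 2) * F ω)) = Real.exp (-(F ω / 2))
    congr 1; ring
  have e2 : ∫ ω, Real.exp (-2 * F' ω) ∂μ = ∫ ω, Real.exp (-F ω) ∂μ := by
    refine integral_congr_ae (ae_of_all _ fun ω => ?_)
    show Real.exp (-2 * ((1 / 2) * F ω)) = Real.exp (-F ω)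
    congr 1; ring
  rw [hS, e1, e2, show 4 * (δ / 2) = 2 * δ by ring] at hmain
  -- combine with the acceptance ceiling
  have hZpos : 0 < ∫ ω, Real.exp (-F ω) ∂μ :=
    integral_exp_pos (integrable_pi_of_continuous _ (Real.continuous_exp.comp hF.neg))
  have hacc := meanAccept_le_sq_integral_exp_neg_half_div (Λ := Λ) (E := E) hF
  have hX0 : 0 ≤ Real.exp (∑ j ∈ T, Real.exp (-2 * M j) *
      (∫ ω, (coordAvg σ (Finset.univ \ T.biUnion B) (h j) ω - ∫ ω', h j ω' ∂μ) ^ 2 ∂μ) / (4 + M j ^ 2)) :=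
    (Real.exp_pos _).le
  calc (∫ ω, (∫ ω', min 1 (Real.exp (F ω - F ω')) ∂μ) ∂μ.tilted (fun ω => -F ω)) *
        Real.exp (∑ j ∈ T, Real.exp (-2 * M j) *
          (∫ ω, (coordAvg σ (Finset.univ \ T.biUnion B) (h j) ω - ∫ ω', h j ω' ∂μ) ^ 2 ∂μ) / (4 + M j ^ 2))
      ≤ (∫ ω, Real.exp (-(F ω / 2)) ∂μ) ^ 2 / (∫ ω, Real.exp (-F ω) ∂μ) *
          Real.exp (∑ j ∈ T, Real.exp (-2 * M j) *
            (∫ ω, (coordAvg σ (Finset.univ \ T.biUnion B) (h j) ω - ∫ ω', h j ω' ∂μ) ^ 2 ∂μ) / (4 + M j ^ 2)) :=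
        mul_le_mul_of_nonneg_right hacc hX0
    _ = (∫ ω, Real.exp (-(F ω / 2)) ∂μ) ^ 2 *
          Real.exp (∑ j ∈ T, Real.exp (-2 * M j) *
            (∫ ω, (coordAvg σ (Finset.univ \ T.biUnion B) (h j) ω - ∫ ω', h j ω' ∂μ) ^ 2 ∂μ) / (4 + M j ^ 2)) /
          ∫ ω, Real.exp (-F ω) ∂μ := by ring
    _ ≤ Real.exp (2 * δ) * (∫ ω, Real.exp (-F ω) ∂μ) / ∫ ω, Real.exp (-F ω) ∂μ :=
        div_le_div_of_nonneg_right hmain hZpos.le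
    _ = Real.exp (2 * δ) := by field_simp

end Blocks

end Summit.Ventures.LatticeQCDFlow.Exactness

end
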